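import Mathlib
import Literature.MathematicalPhysics.QuantumLattice.Imbrie2016.A2WeakBookkeeping
import HarnessLib

/-!
# Imbrie (2016), Ch. 5 residual R2 — the arithmetic of the block-factor ledger
# (c_b = c ε^{-sϰ} of eq. (5.4) and its absorption "s/4 → s/8")

CITATION HEADER (lean-in-tree rule 2026-08-18). J. Z. Imbrie, *On many-body localization for quantum spin chains*,
J. Stat. Phys. **163** (2016) 998–1048, doi 10.1007/s10955-016-1508-x, arXiv:1403.7837 [ImbrieJSP2016], §4.2.1 (dist),
§4.2.3 eqs. (4.18)–(4.19), Ch. 5 eqs. (5.3)–(5.4) and the paragraph following (5.4). WHAT IS REPRODUCED: nothing of the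
proofs; this file kernel-checks the three pieces of elementary arithmetic used by the audit cell `pub-imbrie` (LLA.md block
WB, seat 1 gen 10) in its bookkeeping-level audit of the sentence "a factor of ε^{-sϰ} can be handled with a reduction of the
power from s/4 to s/8 … because the graph size |g_{j'}| is always comparable in size (or longer than) the sum of its block
sizes":

* `sum_scaleL_le` — `Σ_{i ≤ j} L_i ≤ (15/7) L_j` for the scales `L_i = (15/8)^i`;
* `scaleL_div_exp_sqrt_le` — `L_i / d_i ≤ 24 / L_{i + 2 m₀} = 24 (8/15)^{i + 2 m₀}` for the separations
  `d_i = exp(L_{i+m₀}^{1/2})` (from `e^t ≥ t⁴/4!`), so `Σ_i L_i / d_i` is a convergent geometric tail;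
* `rpow_absorb_caseII` — `ε^{s g/4} · ε^{-s ϰ g} ≤ ε^{s g/8}` for `0 < ε ≤ 1`, `s, g ≥ 0`, `ϰ ≤ 1/8` (the printed s/4 → s/8);
* `rpow_absorb_caseI` — `ε^{g} · ε^{-s ϰ C g} ≤ ε^{s g/8}` for `0 < ε ≤ 1`, `0 ≤ s`, `g ≥ 0`, `s ϰ C ≤ 1 - s`
  (single-denominator estimates with one block variable of size `≤ C |g|`).

STATUS: elementary real arithmetic; the combinatorial statements of block WB (which estimates integrate block variables, the
bound Σ_y |b̿^{(i_y)}| ≤ C_WB |g|) are NOT formalised; LLA / Theorem 1.1 are not asserted.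
-/

noncomputable section

namespace Literature.MathematicalPhysics.QuantumLattice.Imbrie2016

open Real Finset

/-- [cite: ImbrieJSP2016, §4.2.1 (dist)] Geometric bookkeeping of the scales `L_i = (15/8)^i`:
`Σ_{i=0}^{j} L_i ≤ (15/7) L_j`. -/
theorem sum_scaleL_le (j : ℕ) :
    ∑ i ∈ Finset.range (j + 1), (15 / 8 : ℝ) ^ i ≤ 15 / 7 * (15 / 8 : ℝ) ^ j := by
  rw [geom_sum_eq (by norm_num : (15 / 8 : ℝ) ≠ 1), div_le_iff₀ (by norm_num : (0 : ℝ) < 15 / 8 - 1),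
    pow_succ]
  have h : (0 : ℝ) < (15 / 8 : ℝ) ^ j := by positivity
  nlinarith [h]

/-- [cite: ImbrieJSP2016, §4.2.1 (dist)] Scale over separation: with `d_i = exp(L_{i+m₀}^{1/2})`,
`L_i / d_i ≤ 24 / L_{i+2m₀}` (from `e^t ≥ t⁴ / 4!` at `t = L_{i+m₀}^{1/2}`), i.e. `≤ 24 (8/15)^{i+2m₀}` — a summable
geometric tail, uniformly small for `m₀` large. -/
theorem scaleL_div_exp_sqrt_le (m₀ i : ℕ) :
    (15 / 8 : ℝ) ^ i / Real.exp (Real.sqrt ((15 / 8 : ℝ) ^ (i + m₀))) ≤ 24 / (15 / 8 : ℝ) ^ (i + 2 * m₀) := by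
  set t : ℝ := Real.sqrt ((15 / 8 : ℝ) ^ (i + m₀)) with ht_def
  have ht : 0 ≤ t := Real.sqrt_nonneg _
  have ht4 : t ^ 4 = (15 / 8 : ℝ) ^ (2 * (i + m₀)) := by
    rw [show (4 : ℕ) = 2 * 2 from rfl, pow_mul, ht_def, Real.sq_sqrt (by positivity), ← pow_mul, mul_comm]
  have hexp : (15 / 8 : ℝ) ^ (2 * (i + m₀)) / 24 ≤ Real.exp t := by
    have h := Real.pow_div_factorial_le_exp t ht 4
    rw [ht4] at h
    have h24 : ((Nat.factorial 4 : ℕ) : ℝ) = 24 := by norm_num [Nat.factorial]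
    rwa [h24] at h
  calc (15 / 8 : ℝ) ^ i / Real.exp t
      ≤ (15 / 8 : ℝ) ^ i / ((15 / 8 : ℝ) ^ (2 * (i + m₀)) / 24) :=
        div_le_div_of_nonneg_left (by positivity) (by positivity) hexp
    _ = 24 / (15 / 8 : ℝ) ^ (i + 2 * m₀) := by
        rw [show 2 * (i + m₀) = i + (i + 2 * m₀) by ring, pow_add]
        have h1 : (0 : ℝ) < (15 / 8 : ℝ) ^ i := by positivity
        have h2 : (0 : ℝ) < (15 / 8 : ℝ) ^ (i + 2 * m₀) := by positivity
        field_simp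

/-- [cite: ImbrieJSP2016, §4.2.1 (dist)] The same bound in the `(8/15)`-form: `L_i / d_i ≤ 24 (8/15)^{i+2m₀}`. -/
theorem scaleL_div_exp_sqrt_le' (m₀ i : ℕ) :
    (15 / 8 : ℝ) ^ i / Real.exp (Real.sqrt ((15 / 8 : ℝ) ^ (i + m₀))) ≤ 24 * (8 / 15 : ℝ) ^ (i + 2 * m₀) := by
  have h := scaleL_div_exp_sqrt_le m₀ i
  have h' : 24 / (15 / 8 : ℝ) ^ (i + 2 * m₀) = 24 * (8 / 15 : ℝ) ^ (i + 2 * m₀) := by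
    rw [div_eq_mul_inv, ← inv_pow]
    norm_num
  linarith [h'.symm.le, h]

/-- [cite: ImbrieJSP2016, eq. (5.4) and eq. (4.19)] **The printed absorption "s/4 → s/8" (case II, conservative per-integral
reading).** For `0 < ε ≤ 1`, `s ≥ 0`, graph length `g ≥ 0` and `ϰ ≤ 1/8`: the `≥ g/4` factors `ε^s` of (4.19) absorb at
most `g` factors `ε^{-sϰ}`, leaving `ε^{s g/8}`. -/
theorem rpow_absorb_caseII {ε s ϰ g : ℝ} (hε : 0 < ε) (hε1 : ε ≤ 1) (hs : 0 ≤ s) (hg : 0 ≤ g)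
    (hϰ : ϰ ≤ 1 / 8) :
    ε ^ (s * g / 4) * ε ^ (-(s * ϰ * g)) ≤ ε ^ (s * g / 8) := by
  rw [← Real.rpow_add hε]
  refine Real.rpow_le_rpow_of_exponent_ge hε hε1 ?_
  have hsg : 0 ≤ s * g := mul_nonneg hs hg
  nlinarith [mul_le_mul_of_nonneg_left hϰ hsg]

/-- [cite: ImbrieJSP2016, eq. (5.4) and §4.2.3 case I] **Absorption in the single-denominator estimates (case I of (4.8))
with one block integration variable.** If the block has size `≤ C g`, `0 < ε ≤ 1`, `0 ≤ s`, `g ≥ 0` and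
`s ϰ C ≤ 1 - s`, then `ε^{g} · ε^{-s ϰ C g} ≤ ε^{s g / 8}`: the case-I rate `ε^{|g|}` survives as at least
`ε^{s|g|/8}`. -/
theorem rpow_absorb_caseI {ε s ϰ C g : ℝ} (hε : 0 < ε) (hε1 : ε ≤ 1) (hs : 0 ≤ s) (hg : 0 ≤ g)
    (hϰ : s * ϰ * C ≤ 1 - s) :
    ε ^ g * ε ^ (-(s * ϰ * C * g)) ≤ ε ^ (s * g / 8) := by
  rw [← Real.rpow_add hε]
  refine Real.rpow_le_rpow_of_exponent_ge hε hε1 ?_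
  have h1 : s * ϰ * C * g ≤ (1 - s) * g := mul_le_mul_of_nonneg_right hϰ hg
  nlinarith [mul_nonneg hs hg]

end Literature.MathematicalPhysics.QuantumLattice.Imbrie2016

end
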